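import Summits.Ventures.LatticeQCDFlow.TrivializingMaps.AbelianGeometricBound

/-!
HONEST FRAMING: exact (Metropolis-corrected) sampling algorithms for lattice gauge theory; figures of
merit are autocorrelation/cost numbers at stated couplings and volumes; no continuum-physics claim.

# AbelianTorus — the periodic lattice `(ℤ/L)^d` as a plaquette complex (`D = 2(d-1)`), and the VOLUME-UNIFORM
gradient bound for the U(1) Lüscher series as a literal theorem quantified over the lattice size:
`Torus.locNorm_luscherCoeffs_le : ∀ d L k e, N_e(a^{(k)}) ≤ ((d-1)/2)·(18(d-1))^k` (THEORY-1.md §12.12)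

Proposed tree path: `Summits/Ventures/LatticeQCDFlow/TrivializingMaps/AbelianTorus.lean` (OURS). Imports
`AbelianGeometricBound.lean`. Contents: sites `Fin d → ZMod L`, links `(x, μ)`, plaquettes `(x, μ<ν)`, the
boundary `χ_{(x,μ<ν)} = δ_{(x,μ)} + δ_{(x+μ̂,ν)} - δ_{(x+ν̂,μ)} - δ_{(x,ν)}`; proofs of `|χ| ≤ 1`, `‖χ‖₁ ≤ 4`, and
"at most `2(d-1)` plaquettes through a link"; the complex `Torus.complex d L`; the bound for EVERY `L ≥ 1`
(`[NeZero L]`) with right-hand side free of `L`; the girth-4 refinement (ratio `6(d-1)`) conditional on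
`CycleGirthFour (Torus.complex d L)` (true for `L ≥ 4`; row R-T1-10b). Kernel-checked: 0 sorries, axioms
{propext, Classical.choice, Quot.sound}. Cell `lqcd-flow`, unit `pub-lqcd-theory1-g3`, 2026-08-21.
-/

namespace Summit.Ventures.LatticeQCDFlow.TrivializingMaps.Abelian

open Finset

noncomputable section

namespace Torus

variable (d L : ℕ)

/-- Sites of the periodic lattice `(ℤ/L)^d`. -/
abbrev Site := Fin d → ZMod L

/-- Links `(x, μ)`, from `x` to `x + μ̂`. -/
abbrev Link := Site d L × Fin d

/-- Plaquettes `(x, μ < ν)`. -/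
abbrev Plaq := Site d L × {a : Fin d × Fin d // a.1 < a.2}

variable {d L}

/-- The unit shift `x ↦ x + μ̂`. -/
def shift (x : Site d L) (μ : Fin d) : Site d L := x + Pi.single μ 1

/-- Indicator of one link, as an integer mode `δ_l`. -/
def δ (l : Link d L) : Mode (Link d L) := fun e => if e = l then 1 else 0

/-- Oriented boundary of the plaquette `(x, μ<ν)` (Lüscher's plaquette loop
`U(x,μ) U(x+μ̂,ν) U(x+ν̂,μ)⁻¹ U(x,ν)⁻¹`): `δ_{(x,μ)} + δ_{(x+μ̂,ν)} - δ_{(x+ν̂,μ)} - δ_{(x,ν)}`. -/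
def bdry : Plaq d L → Mode (Link d L)
  | (x, ⟨(μ, ν), _⟩) => δ (x, μ) + δ (shift x μ, ν) - δ (shift x ν, μ) - δ (x, ν)

/-- Unfolding `δ`. -/
theorem δ_apply (l e : Link d L) : δ l e = if e = l then 1 else 0 := rfl

/-- `δ_l ≥ 0`. -/
theorem δ_nonneg (l e : Link d L) : 0 ≤ δ l e := by
  rw [δ_apply]; split_ifs <;> norm_num

/-- Entries of a plaquette boundary lie in `{0, ±1}` (the two `+` links differ in direction, and so do the
two `-` links, because `μ ≠ ν`). -/
theorem abs_bdry_le (p : Plaq d L) (e : Link d L) : |bdry p e| ≤ 1 := by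
  obtain ⟨x, ⟨⟨μ, ν⟩, hμν⟩⟩ := p
  have hne : μ ≠ ν := ne_of_lt hμν
  have hA : ¬ (e = (x, μ) ∧ e = (shift x μ, ν)) := fun ⟨h1, h2⟩ =>
    hne (by rw [h1] at h2; exact (Prod.ext_iff.1 h2).2)
  have hB : ¬ (e = (shift x ν, μ) ∧ e = (x, ν)) := fun ⟨h1, h2⟩ =>
    hne (by rw [h1] at h2; exact (Prod.ext_iff.1 h2).2)
  simp only [bdry, Pi.add_apply, Pi.sub_apply, δ_apply]
  split_ifs <;>
    first | exact (hA ⟨‹_›, ‹_›⟩).elim | exact (hB ⟨‹_›, ‹_›⟩).elim | norm_num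

/-- The (at most two per transverse direction) plaquettes through the link `(y, λ)`, as a union of
`≤ 1`-element sets indexed by `(κ, b) ∈ (directions ≠ λ) × Bool` (`b` = whether the base point is `y`
or `y - κ̂`). -/
def through (y : Site d L) (lam κ : Fin d) (b : Bool) : Finset (Plaq d L) :=
  if h : lam < κ then {(if b then y else y - Pi.single κ 1, ⟨(lam, κ), h⟩)}
  else if h' : κ < lam then {(if b then y else y - Pi.single κ 1, ⟨(κ, lam), h'⟩)}
  else ∅

/-- Each `through y λ κ b` has at most one element. -/
theorem card_through_le (y : Site d L) (lam κ : Fin d) (b : Bool) : (through y lam κ b).card ≤ 1 := by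
  unfold through
  split_ifs <;> simp

/-- A plaquette whose boundary contains the link `(y, λ)` is one of the `through y λ κ b`, `κ ≠ λ`. -/
theorem mem_through_of_bdry_ne_zero (p : Plaq d L) (y : Site d L) (lam : Fin d)
    (hp : bdry p (y, lam) ≠ 0) :
    ∃ κ, κ ≠ lam ∧ ∃ b, p ∈ through y lam κ b := by
  obtain ⟨x, ⟨⟨μ, ν⟩, hμν⟩⟩ := p
  have hνμ : ¬ ν < μ := lt_asymm hμν
  by_cases h1 : ((y, lam) : Link d L) = (x, μ)
  · simp only [Prod.mk.injEq] at h1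
    obtain ⟨rfl, rfl⟩ := h1
    exact ⟨ν, ne_of_gt hμν, true, by simp [through, dif_pos hμν]⟩
  by_cases h2 : ((y, lam) : Link d L) = (shift x μ, ν)
  · simp only [Prod.mk.injEq] at h2
    obtain ⟨rfl, rfl⟩ := h2
    refine ⟨μ, ne_of_lt hμν, false, ?_⟩
    simp [through, dif_neg hνμ, dif_pos hμν, shift]
  by_cases h3 : ((y, lam) : Link d L) = (shift x ν, μ)
  · simp only [Prod.mk.injEq] at h3
    obtain ⟨rfl, rfl⟩ := h3
    refine ⟨ν, ne_of_gt hμν, false, ?_⟩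
    simp [through, dif_pos hμν, shift]
  by_cases h4 : ((y, lam) : Link d L) = (x, ν)
  · simp only [Prod.mk.injEq] at h4
    obtain ⟨rfl, rfl⟩ := h4
    refine ⟨μ, ne_of_lt hμν, true, ?_⟩
    simp [through, dif_neg hνμ, dif_pos hμν]
  exfalso; apply hp
  simp [bdry, δ_apply, h1, h2, h3, h4]

section Finite

variable [NeZero L]

/-- `∑_e δ_l(e) = 1`. -/
theorem sum_δ (l : Link d L) : ∑ e, δ l e = 1 := by
  simp only [δ_apply, Finset.sum_ite_eq', Finset.mem_univ, if_true]

/-- `‖bdry p‖₁ ≤ 4` (pointwise triangle inequality over the four indicators). -/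
theorem l1_bdry_le (p : Plaq d L) : l1 (bdry p) ≤ 4 := by
  obtain ⟨x, ⟨⟨μ, ν⟩, hμν⟩⟩ := p
  unfold l1
  have key : ∀ e, |bdry (x, ⟨(μ, ν), hμν⟩) e| ≤
      δ (x, μ) e + δ (shift x μ, ν) e + δ (shift x ν, μ) e + δ (x, ν) e := by
    intro e
    simp only [bdry, Pi.add_apply, Pi.sub_apply, δ_apply]
    split_ifs <;> norm_num
  calc ∑ e, |bdry (x, ⟨(μ, ν), hμν⟩) e|
      ≤ ∑ e, (δ (x, μ) e + δ (shift x μ, ν) e + δ (shift x ν, μ) e + δ (x, ν) e) :=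
        Finset.sum_le_sum fun e _ => key e
    _ = 4 := by simp only [Finset.sum_add_distrib, sum_δ]; norm_num

/-- At most `2(d-1)` plaquettes through any link. -/
theorem card_filter_bdry_le (e : Link d L) :
    (Finset.univ.filter fun p : Plaq d L => bdry p e ≠ 0).card ≤ 2 * (d - 1) := by
  obtain ⟨y, lam⟩ := e
  set s : Finset (Fin d × Bool) := (Finset.univ.erase lam) ×ˢ Finset.univ with hs
  have hsub : (Finset.univ.filter fun p : Plaq d L => bdry p (y, lam) ≠ 0) ⊆
      s.biUnion fun kb => through y lam kb.1 kb.2 := by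
    intro p hp
    rw [Finset.mem_filter] at hp
    obtain ⟨κ, hκ, b, hb⟩ := mem_through_of_bdry_ne_zero p y lam hp.2
    rw [Finset.mem_biUnion]
    exact ⟨(κ, b), by simp [hs, hκ], hb⟩
  calc (Finset.univ.filter fun p : Plaq d L => bdry p (y, lam) ≠ 0).card
      ≤ (s.biUnion fun kb => through y lam kb.1 kb.2).card := Finset.card_le_card hsub
    _ ≤ ∑ kb ∈ s, (through y lam kb.1 kb.2).card := Finset.card_biUnion_le
    _ ≤ ∑ kb ∈ s, 1 := Finset.sum_le_sum fun kb _ => card_through_le y lam kb.1 kb.2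
    _ = 2 * (d - 1) := by
        simp only [Finset.sum_const, smul_eq_mul, mul_one, hs, Finset.card_product,
          Finset.card_erase_of_mem (Finset.mem_univ _), Finset.card_univ, Fintype.card_fin,
          Fintype.card_bool]
        ring

variable (d L)

/-- **The torus `(ℤ/L)^d` as a plaquette complex**, `D = 2(d-1)`. -/
def complex : PlaquetteComplex (Link d L) (Plaq d L) where
  χ := bdry
  abs_χ_le := abs_bdry_le
  l1_χ_le := l1_bdry_le
  D := 2 * (d - 1)
  card_filter_le := card_filter_bdry_le

/-- **THEOREM (volume-uniform geometric gradient bound on the torus, U(1), literal form)** — OURS, PROVED.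
For every dimension `d`, EVERY lattice size `L ≥ 1`, every order `k` and every link `e` of `(ℤ/L)^d`, the
Fourier-side gradient norm of the `k`-th Lüscher coefficient functional of the U(1) Wilson action obeys
`N_e(a^{(k)}) ≤ ((d-1)/2) · (18(d-1))^k`; the right-hand side does not mention `L`. Hence the gradient series
`∑_k t^k ∂_e s_k` (the generator a trivializing-flow HMC integrates) converges for `|t| β < 1/(18(d-1))`
uniformly in the volume (with `abs_gradFormula_le_locNorm`). The girth-4 refinement (`tβ < 1/(6(d-1))`,
THEORY-1 §12.4) holds under `CycleGirthFour (complex d L)`, true for `L ≥ 4` (row R-T1-10b). -/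
theorem locNorm_luscherCoeffs_le (k : ℕ) (e : Link d L) :
    locNorm e (luscherCoeffs (complex d L) k) ≤ ((2 * (d - 1) : ℕ) : ℝ) / 4 * (9 * ((2 * (d - 1) : ℕ) : ℝ)) ^ k :=
  abelianGeometricGradientBound_one (complex d L) k e

/-- The girth-4 refinement on the torus, conditional on `CycleGirthFour` (ratio `6(d-1)` instead of `18(d-1)`). -/
theorem locNorm_luscherCoeffs_le_of_girth (h4 : CycleGirthFour (complex d L)) (k : ℕ) (e : Link d L) :
    locNorm e (luscherCoeffs (complex d L) k) ≤ ((2 * (d - 1) : ℕ) : ℝ) / 4 * (3 * ((2 * (d - 1) : ℕ) : ℝ)) ^ k :=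
  abelianGeometricGradientBound (complex d L) h4 k e

end Finite

end Torus

end

end Summit.Ventures.LatticeQCDFlow.TrivializingMaps.Abelian
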